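import Mathlib.MeasureTheory.Integral.IntervalIntegral.FundThmCalculus
import Mathlib.Analysis.SpecialFunctions.Integrals.Basic
import Mathlib.RingTheory.Coprime.Lemmas
import Mathlib.Data.Int.ModEq
import HarnessLib

/-!
# Node weights of `ζ`-mollified combs, sharp evaluation II: sums along arithmetic progressions

Topic `Literature/NumberTheory/LFunctions`.  In the lattice organisation of the node weights of a
`ζ`-mollified resonator comb (see `Literature/NumberTheory/LFunctions/WeilCombBumpPeriodization.lean`)
the family `j = gm` of the lattice `{(j, k') : ℓ ∣ nℓ'k' + j}` is an arithmetic progression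
`k' ≡ r (mod P)` (`P = ℓ/g`), carrying the weight `f_m(k') = B(mK₀/k')/k'`.  This file compares the
sum of such a weight along a progression with `(1/P) ∫ f`:

* `abs_sum_prog_sub_integral_le` — for `C¹` `f` with `|f| ≤ S` on `[0, ∞)` and
  `|f'(s)| ≤ 4D/(s + s₀)²` on `(0, ∞)`:
  `|∑_{t < T} f(r + Pt) - (1/P) ∫_0^N f| ≤ 3S + 4D/s₀` (`1 ≤ r ≤ P`, the progression is the part of
  `r + Pℕ` in `[1, N]`);
* `exists_prog_param` — `{k ∈ [1, N] : P ∣ m + Qk}` (`gcd(Q, P) = 1`) is such a progression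
  (`1 ≤ r ≤ P`, `T` terms), as an identity of sums.

The weight `f_m` itself is treated in `Literature/NumberTheory/LFunctions/WeilCombFamilyWeights.lean`.

Everything is proved; no named facts (folklore real analysis and elementary number theory).
-/

noncomputable section

open MeasureTheory Set intervalIntegral Filter
open scoped Topology

namespace Literature.NumberTheory.LFunctions

/-! ## A progression sum against the integral -/

/-- One cell: for `C¹` `f` and `a ≤ b` with `b - a = P > 0`,
`|f(b) - (1/P) ∫_a^b f| ≤ ∫_a^b |f'|`. [folklore] -/
theorem abs_sub_avg_integral_le {f f' : ℝ → ℝ} (hf : ∀ s, HasDerivAt f (f' s) s)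
    (hf'c : Continuous f') {a b P : ℝ} (hP : 0 < P) (hab : b - a = P) :
    |f b - 1 / P * ∫ s in a..b, f s| ≤ ∫ s in a..b, |f' s| := by
  have hle : a ≤ b := by linarith
  have hfc : Continuous f := continuous_iff_continuousAt.2 fun s ↦ (hf s).continuousAt
  set C : ℝ := ∫ s in a..b, |f' s| with hC
  have hC0 : 0 ≤ C := intervalIntegral.integral_nonneg hle fun s _ ↦ abs_nonneg _
  -- `f b - (1/P)∫ f = (1/P) ∫ (f b - f s) ds`
  have hrepr : f b - 1 / P * ∫ s in a..b, f s = 1 / P * ∫ s in a..b, (f b - f s) := by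
    rw [intervalIntegral.integral_sub intervalIntegrable_const (hfc.intervalIntegrable _ _),
      intervalIntegral.integral_const, smul_eq_mul, hab]
    field_simp
  rw [hrepr]
  -- `|f b - f s| ≤ C` on the cell
  have hbound : ∀ s ∈ Set.uIoc a b, ‖f b - f s‖ ≤ C := by
    intro s hs
    rw [uIoc_of_le hle] at hs
    have hsb : s ≤ b := hs.2
    have hFTC : ∫ x in s..b, f' x = f b - f s :=
      intervalIntegral.integral_eq_sub_of_hasDerivAt (fun x _ ↦ hf x) (hf'c.intervalIntegrable _ _)
    rw [Real.norm_eq_abs, ← hFTC]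
    calc |∫ x in s..b, f' x| ≤ ∫ x in s..b, |f' x| := intervalIntegral.abs_integral_le_integral_abs hsb
      _ ≤ C := intervalIntegral.integral_mono_interval hs.1.le hsb le_rfl
          (Eventually.of_forall fun x ↦ abs_nonneg _) ((hf'c.abs).intervalIntegrable _ _)
  have hnorm := intervalIntegral.norm_integral_le_of_norm_le_const hbound
  rw [Real.norm_eq_abs, show |b - a| = P by rw [hab, abs_of_pos hP]] at hnorm
  rw [abs_mul, abs_of_pos (by positivity : (0 : ℝ) < 1 / P)]
  calc 1 / P * |∫ s in a..b, (f b - f s)| ≤ 1 / P * (C * P) :=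
        mul_le_mul_of_nonneg_left hnorm (by positivity)
    _ = C := by field_simp

/-- `∫_a^b 4D/(s + s₀)² ds = 4D (1/(a + s₀) - 1/(b + s₀))` for `0 ≤ a ≤ b`, `s₀ > 0`. [folklore] -/
theorem integral_four_mul_div_sq {D s₀ a b : ℝ} (hs₀ : 0 < s₀) (ha : 0 ≤ a) (hab : a ≤ b) :
    ∫ s in a..b, 4 * D / (s + s₀) ^ 2 = 4 * D * (1 / (a + s₀) - 1 / (b + s₀)) := by
  have hderiv : ∀ x ∈ uIcc a b, HasDerivAt (fun s ↦ -(4 * D) / (s + s₀)) (4 * D / (x + s₀) ^ 2) x := by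
    intro x hx
    rw [uIcc_of_le hab] at hx
    have hx0 : 0 < x + s₀ := by linarith [hx.1]
    have h1 : HasDerivAt (fun s ↦ s + s₀) 1 x := (hasDerivAt_id x).add_const s₀
    have h2 := (h1.inv hx0.ne').const_mul (-(4 * D))
    refine h2.congr_deriv ?_
    field_simp
  have hcont : ContinuousOn (fun x ↦ 4 * D / (x + s₀) ^ 2) (uIcc a b) := by
    refine continuousOn_const.div ((continuousOn_id.add continuousOn_const).pow 2) fun x hx ↦ ?_
    rw [uIcc_of_le hab] at hx
    have : 0 < x + s₀ := by linarith [hx.1]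
    positivity
  rw [intervalIntegral.integral_eq_sub_of_hasDerivAt hderiv (hcont.intervalIntegrable)]
  have h1 : 0 < a + s₀ := by linarith
  have h2 : 0 < b + s₀ := by linarith
  field_simp
  ring

/-- **A progression sum against the integral.** Let `f` be `C¹` on `ℝ` with `|f| ≤ S` on
`[0, ∞)` and `|f'(s)| ≤ 4D/(s + s₀)²` on `(0, ∞)` (`s₀ > 0`, `D ≥ 0`).  For `1 ≤ r ≤ P`, `T` terms
and `N ≥ 0` with `r + P(T-1) ≤ N < r + PT` (the progression `r + Pℕ` meets `[1, N]` in exactly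
`T` terms): `|∑_{t<T} f(r + Pt) - (1/P) ∫_0^N f| ≤ 3S + 4D/s₀`.  (Each term is the average of `f`
over the cell of length `P` to its left up to `∫_cell |f'|`; the first term and the last
incomplete cell cost `≤ 3S`.) [folklore] -/
theorem abs_sum_prog_sub_integral_le {f f' : ℝ → ℝ} {D S s₀ N : ℝ} {P r T : ℕ}
    (hf : ∀ s, HasDerivAt f (f' s) s) (hf'c : Continuous f') (hs₀ : 0 < s₀) (hD0 : 0 ≤ D)
    (hD : ∀ s, 0 < s → |f' s| ≤ 4 * D / (s + s₀) ^ 2) (hS : ∀ s, 0 ≤ s → |f s| ≤ S)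
    (hP : 1 ≤ P) (hr : 1 ≤ r) (hrP : r ≤ P) (hN0 : 0 ≤ N) (hNT : N < r + P * T)
    (hTN : 1 ≤ T → (r : ℝ) + P * ((T - 1 : ℕ) : ℝ) ≤ N) :
    |∑ t ∈ Finset.range T, f (r + P * t) - 1 / P * ∫ s in (0 : ℝ)..N, f s| ≤ 3 * S + 4 * D / s₀ := by
  have hfc : Continuous f := continuous_iff_continuousAt.2 fun s ↦ (hf s).continuousAt
  have hS0 : 0 ≤ S := (abs_nonneg _).trans (hS 0 le_rfl)
  have hPR : (1 : ℝ) ≤ P := by exact_mod_cast hP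
  have hP0 : (0 : ℝ) < P := by linarith
  have hrR : (1 : ℝ) ≤ r := by exact_mod_cast hr
  have hrPR : (r : ℝ) ≤ P := by exact_mod_cast hrP
  have hDs : 0 ≤ 4 * D / s₀ := by positivity
  -- a short integral of `f` over `[u, w] ⊆ [0, ∞)` of length `≤ P` is `≤ S P`
  have hshort : ∀ u w : ℝ, 0 ≤ u → u ≤ w → w - u ≤ P → |1 / P * ∫ s in u..w, f s| ≤ S := by
    intro u w hu huw hwu
    have hb : ∀ s ∈ Set.uIoc u w, ‖f s‖ ≤ S := fun s hs ↦ by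
      rw [uIoc_of_le huw] at hs
      rw [Real.norm_eq_abs]
      exact hS s (hu.trans hs.1.le)
    have h1 := intervalIntegral.norm_integral_le_of_norm_le_const hb
    rw [Real.norm_eq_abs, abs_of_nonneg (by linarith : 0 ≤ w - u)] at h1
    rw [abs_mul, abs_of_pos (by positivity : (0 : ℝ) < 1 / P)]
    calc 1 / P * |∫ s in u..w, f s| ≤ 1 / P * (S * P) := by
          refine mul_le_mul_of_nonneg_left (h1.trans ?_) (by positivity)
          exact mul_le_mul_of_nonneg_left hwu hS0
      _ = S := by field_simp
  rcases Nat.eq_zero_or_pos T with hT | hT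
  · -- no terms: `N < r ≤ P`
    subst hT
    simp only [Finset.range_zero, Finset.sum_empty, zero_sub, abs_neg, Nat.cast_zero, mul_zero,
      add_zero] at hNT ⊢
    exact (hshort 0 N le_rfl hN0 (by linarith)).trans (by linarith)
  · obtain ⟨T', rfl⟩ : ∃ T', T = T' + 1 := ⟨T - 1, by omega⟩
    simp only [Nat.add_sub_cancel] at hTN
    have hTN' := hTN (by omega)
    -- nodes `k t = r + P t`
    set k : ℕ → ℝ := fun t ↦ (r : ℝ) + P * t with hk
    have hk0 : k 0 = r := by simp [hk]
    have hkpos : ∀ t, 0 < k t := fun t ↦ by simp only [hk]; positivity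
    have hkmono : ∀ t, k t ≤ k (t + 1) := fun t ↦ by simp only [hk]; push_cast; nlinarith
    have hkstep : ∀ t, k (t + 1) - k t = P := fun t ↦ by simp only [hk]; push_cast; ring
    have hkT' : k T' ≤ N := by simpa [hk] using hTN'
    have hNk : N < k T' + P := by push_cast at hNT; simp only [hk]; linarith
    -- the sum of values
    rw [Finset.sum_range_succ' (fun t ↦ f (r + P * t))]
    simp only [Nat.cast_add, Nat.cast_one, Nat.cast_zero, mul_zero, add_zero]
    have hvals : ∀ i : ℕ, f ((r : ℝ) + P * ((i : ℝ) + 1)) = f (k (i + 1)) := fun i ↦ by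
      simp [hk]
    simp only [hvals]
    -- split the integral at `k 0 = r`, `k T'`
    have hii : ∀ u w : ℝ, IntervalIntegrable f volume u w := fun u w ↦ hfc.intervalIntegrable _ _
    have hsplit : ∫ s in (0 : ℝ)..N, f s
        = (∫ s in (0 : ℝ)..k 0, f s) + (∑ i ∈ Finset.range T', ∫ s in k i..k (i + 1), f s)
          + ∫ s in k T'..N, f s := by
      rw [intervalIntegral.sum_integral_adjacent_intervals (fun i _ ↦ hii _ _),
        intervalIntegral.integral_add_adjacent_intervals (hii _ _) (hii _ _),
        intervalIntegral.integral_add_adjacent_intervals (hii _ _) (hii _ _)]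
    rw [hsplit]
    have halg : ∑ i ∈ Finset.range T', f (k (i + 1)) + f r
        - 1 / P * ((∫ s in (0 : ℝ)..k 0, f s) + (∑ i ∈ Finset.range T', ∫ s in k i..k (i + 1), f s)
          + ∫ s in k T'..N, f s)
        = (f r - 1 / P * ∫ s in (0 : ℝ)..k 0, f s)
          + ∑ i ∈ Finset.range T', (f (k (i + 1)) - 1 / P * ∫ s in k i..k (i + 1), f s)
          - 1 / P * ∫ s in k T'..N, f s := by
      rw [Finset.sum_sub_distrib, ← Finset.mul_sum]
      ring
    rw [halg]
    -- the three pieces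
    have h1 : |f r - 1 / P * ∫ s in (0 : ℝ)..k 0, f s| ≤ 2 * S := by
      calc |f r - 1 / P * ∫ s in (0 : ℝ)..k 0, f s|
          ≤ |f r| + |1 / P * ∫ s in (0 : ℝ)..k 0, f s| := abs_sub _ _
        _ ≤ S + S := add_le_add (hS r (by linarith)) (hshort 0 (k 0) le_rfl (by rw [hk0]; linarith)
            (by rw [hk0]; linarith))
        _ = 2 * S := by ring
    have h3 : |1 / P * ∫ s in k T'..N, f s| ≤ S :=
      hshort (k T') N (hkpos T').le hkT' (by linarith)
    have h2 : |∑ i ∈ Finset.range T', (f (k (i + 1)) - 1 / P * ∫ s in k i..k (i + 1), f s)|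
        ≤ 4 * D / s₀ := by
      calc |∑ i ∈ Finset.range T', (f (k (i + 1)) - 1 / P * ∫ s in k i..k (i + 1), f s)|
          ≤ ∑ i ∈ Finset.range T', |f (k (i + 1)) - 1 / P * ∫ s in k i..k (i + 1), f s| :=
            Finset.abs_sum_le_sum_abs _ _
        _ ≤ ∑ i ∈ Finset.range T', ∫ s in k i..k (i + 1), |f' s| :=
            Finset.sum_le_sum fun i _ ↦ abs_sub_avg_integral_le hf hf'c hP0 (hkstep i)
        _ = ∫ s in k 0..k T', |f' s| :=
            intervalIntegral.sum_integral_adjacent_intervals fun i _ ↦ (hf'c.abs).intervalIntegrable _ _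
        _ ≤ ∫ s in k 0..k T', 4 * D / (s + s₀) ^ 2 := by
            have hle : k 0 ≤ k T' := by
              simp only [hk]; push_cast; nlinarith [(T'.cast_nonneg : (0 : ℝ) ≤ T')]
            refine intervalIntegral.integral_mono_on hle ((hf'c.abs).intervalIntegrable _ _) ?_ ?_
            · refine (continuousOn_const.div ((continuousOn_id.add continuousOn_const).pow 2)
                fun x hx ↦ ?_).intervalIntegrable_of_Icc hle
              have hx0 : 0 < x + s₀ := by linarith [hx.1, hkpos 0]
              exact (pow_pos hx0 2).ne'
            · intro s hs
              exact hD s (lt_of_lt_of_le (hkpos 0) hs.1)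
        _ = 4 * D * (1 / (k 0 + s₀) - 1 / (k T' + s₀)) :=
            integral_four_mul_div_sq hs₀ (hkpos 0).le (by
              simp only [hk]; push_cast; nlinarith [(T'.cast_nonneg : (0 : ℝ) ≤ T')])
        _ ≤ 4 * D / s₀ := by
            rw [div_eq_mul_one_div (4 * D) s₀]
            refine mul_le_mul_of_nonneg_left ?_ (by positivity)
            have ha : 1 / (k 0 + s₀) ≤ 1 / s₀ :=
              one_div_le_one_div_of_le hs₀ (by linarith [hkpos 0])
            have hb : 0 ≤ 1 / (k T' + s₀) := by have := hkpos T'; positivity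
            linarith
    calc |(f r - 1 / P * ∫ s in (0 : ℝ)..k 0, f s)
          + ∑ i ∈ Finset.range T', (f (k (i + 1)) - 1 / P * ∫ s in k i..k (i + 1), f s)
          - 1 / P * ∫ s in k T'..N, f s|
        ≤ |(f r - 1 / P * ∫ s in (0 : ℝ)..k 0, f s)
          + ∑ i ∈ Finset.range T', (f (k (i + 1)) - 1 / P * ∫ s in k i..k (i + 1), f s)|
          + |1 / P * ∫ s in k T'..N, f s| := abs_sub _ _
      _ ≤ (|f r - 1 / P * ∫ s in (0 : ℝ)..k 0, f s|
          + |∑ i ∈ Finset.range T', (f (k (i + 1)) - 1 / P * ∫ s in k i..k (i + 1), f s)|)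
          + |1 / P * ∫ s in k T'..N, f s| := add_le_add (abs_add_le _ _) le_rfl
      _ ≤ (2 * S + 4 * D / s₀) + S := add_le_add (add_le_add h1 h2) h3
      _ = 3 * S + 4 * D / s₀ := by ring

/-! ## The progression `{k ∈ [1, N] : P ∣ m + Qk}` -/

/-- **Parametrising a family.** For `P ≥ 1`, `Q` coprime to `P`, an integer `m` and `N : ℕ` there
are `1 ≤ r ≤ P` and `T` with `r + P(T-1) ≤ N < r + PT` (when `T ≥ 1`) such that
`{k ∈ [1, N] : P ∣ m + Qk} = {r + Pt : t < T}`, as an identity of sums. [folklore] -/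
theorem exists_prog_param {P Q : ℕ} (hP : 1 ≤ P) (hQP : Nat.Coprime Q P) (m : ℤ) (N : ℕ) :
    ∃ r T : ℕ, 1 ≤ r ∧ r ≤ P ∧ N < r + P * T ∧ (1 ≤ T → r + P * (T - 1) ≤ N) ∧
      ∀ F : ℕ → ℝ, ∑ k ∈ (Finset.Icc 1 N).filter (fun k : ℕ ↦ (P : ℤ) ∣ m + Q * k), F k
        = ∑ t ∈ Finset.range T, F (r + P * t) := by
  have hPZ : (0 : ℤ) < P := by exact_mod_cast hP
  -- Bezout: `u Q + v P = 1`
  obtain ⟨u, v, huv⟩ := Nat.isCoprime_iff_coprime.2 hQP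
  -- a residue `r₀ ∈ [0, P)` with `P ∣ m + Q r₀`
  set r₀ : ℤ := (-m * u) % P with hr₀
  have hr₀0 : 0 ≤ r₀ := Int.emod_nonneg _ hPZ.ne'
  have hr₀P : r₀ < P := Int.emod_lt_of_pos _ hPZ
  have hr₀dvd : (P : ℤ) ∣ m + Q * r₀ := by
    have h1 : r₀ ≡ -m * u [ZMOD P] := Int.mod_modEq _ _
    have h2 : m + Q * r₀ ≡ m + Q * (-m * u) [ZMOD P] := (h1.mul_left _).add_left _
    have h3 : m + Q * (-m * u) = (m * v) * P := by linear_combination (-m) * huv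
    rw [h3] at h2
    exact (Int.modEq_zero_iff_dvd.1 (h2.trans (Int.modEq_zero_iff_dvd.2 (dvd_mul_left _ _))))
  -- the representative `r ∈ [1, P]`
  set r : ℕ := if r₀ = 0 then P else r₀.toNat with hr
  have hr1 : 1 ≤ r := by
    simp only [hr]; split_ifs with h
    · exact hP
    · have : 0 < r₀ := lt_of_le_of_ne hr₀0 (Ne.symm h); omega
  have hrP : r ≤ P := by
    simp only [hr]; split_ifs with h
    · exact le_rfl
    · omega
  have hrr₀ : (P : ℤ) ∣ (r : ℤ) - r₀ := by
    simp only [hr]; split_ifs with h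
    · rw [h, sub_zero]
    · rw [Int.toNat_of_nonneg hr₀0, sub_self]; exact dvd_zero _
  have hrdvd : (P : ℤ) ∣ m + Q * r := by
    have : m + Q * (r : ℤ) = (m + Q * r₀) + Q * ((r : ℤ) - r₀) := by ring
    rw [this]; exact dvd_add hr₀dvd (dvd_mul_of_dvd_right hrr₀ _)
  -- `P ∣ m + Qk ↔ P ∣ k - r`
  have hPQ : IsCoprime (P : ℤ) (Q : ℤ) := (Nat.isCoprime_iff_coprime.2 hQP).symm
  have hiff : ∀ k : ℕ, (P : ℤ) ∣ m + Q * k ↔ (P : ℤ) ∣ (k : ℤ) - r := by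
    intro k
    have hsplit : m + Q * (k : ℤ) = (m + Q * r) + Q * ((k : ℤ) - r) := by ring
    constructor
    · intro h
      have h' : (P : ℤ) ∣ Q * ((k : ℤ) - r) := by
        have := dvd_sub h hrdvd; rwa [hsplit, add_sub_cancel_left] at this
      exact hPQ.dvd_of_dvd_mul_left h'
    · intro h
      rw [hsplit]; exact dvd_add hrdvd (dvd_mul_of_dvd_right h _)
  -- the number of terms
  set T : ℕ := (N + P - r) / P with hT
  have hP0 : 0 < P := hP
  have hTup : N < r + P * T := by
    have h1 : N + P - r < (N + P - r) / P * P + P := Nat.lt_div_mul_add hP0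
    rw [← hT, mul_comm] at h1
    omega
  have hTlow : 1 ≤ T → r + P * (T - 1) ≤ N := by
    intro hT1
    have h1 : (N + P - r) / P * P ≤ N + P - r := Nat.div_mul_le_self _ _
    rw [← hT, mul_comm] at h1
    have h2 : P * (T - 1) + P = P * T := by
      rw [← Nat.mul_add_one, Nat.sub_add_cancel hT1]
    omega
  -- the progression as an image
  have hset : (Finset.Icc 1 N).filter (fun k : ℕ ↦ (P : ℤ) ∣ m + Q * k)
      = (Finset.range T).image (fun t ↦ r + P * t) := by
    ext k
    simp only [Finset.mem_filter, Finset.mem_Icc, Finset.mem_image, Finset.mem_range, hiff k]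
    constructor
    · rintro ⟨⟨hk1, hkN⟩, ⟨z, hz⟩⟩
      -- `z ≥ 0`
      have hz0 : 0 ≤ z := by
        by_contra hneg
        have hz1 : z ≤ -1 := by omega
        have hmul : (P : ℤ) * z ≤ (P : ℤ) * (-1) := mul_le_mul_of_nonneg_left hz1 hPZ.le
        have hk1' : (1 : ℤ) ≤ k := by exact_mod_cast hk1
        have hrP' : (r : ℤ) ≤ P := by exact_mod_cast hrP
        linarith
      refine ⟨z.toNat, ?_, ?_⟩
      · -- `t < T`
        have hzt : ((z.toNat : ℕ) : ℤ) = z := Int.toNat_of_nonneg hz0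
        have hkeq : (k : ℤ) = r + P * (z.toNat : ℕ) := by rw [hzt]; linarith
        have hkeq' : k = r + P * z.toNat := by exact_mod_cast hkeq
        have hle : r + P * z.toNat ≤ N := hkeq' ▸ hkN
        have h3 : z.toNat + 1 ≤ T := by
          rw [hT, Nat.le_div_iff_mul_le hP0]
          have e : (z.toNat + 1) * P = P * z.toNat + P := by ring
          rw [e]
          omega
        omega
      · have hzt : ((z.toNat : ℕ) : ℤ) = z := Int.toNat_of_nonneg hz0
        have hkeq : (k : ℤ) = r + P * (z.toNat : ℕ) := by rw [hzt]; linarith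
        exact_mod_cast hkeq.symm
    · rintro ⟨t, ht, rfl⟩
      have h3 : t + 1 ≤ T := ht
      rw [hT, Nat.le_div_iff_mul_le hP0] at h3
      have e : (t + 1) * P = P * t + P := by ring
      rw [e] at h3
      refine ⟨⟨by omega, by omega⟩, ⟨t, ?_⟩⟩
      push_cast
      ring
  refine ⟨r, T, hr1, hrP, hTup, hTlow, fun F ↦ ?_⟩
  rw [hset, Finset.sum_image]
  intro t₁ _ t₂ _ h
  have h' : r + P * t₁ = r + P * t₂ := h
  have : P * t₁ = P * t₂ := by omega
  exact Nat.eq_of_mul_eq_mul_left hP0 this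

end Literature.NumberTheory.LFunctions
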